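import Summits.CriticalPhenomena.PercolationContinuityZ3.Theorems.PercNearOneGluingNoHeavyLowerTailSahiOneStepSharedBitPrelim
import Mathlib.Algebra.BigOperators.Intervals
import HarnessLib

/-!
# Three Hamming thresholds, I: likelihood-ratio order, log-concave CDFs, Chebyshev with zero-weight exceptions

Prover prim-ineq-prove-3 gen 26 (`--supports stmt-CriticalPhenomena-4575`; memo `run/shared/lean/prim/prim-ineq-prove-3/FINDING-G26B-THREE-THRESHOLDS.md` §1, §3).  No definitions, no sorries.
Generic finite-sum lemmas for the proof of `(2′)` / Kahn C5 for three Hamming-threshold events (`…ThresholdsGrid`,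
`…ThreeThresholds`): `mlr_sum_le` (likelihood-ratio order ⇒ ordered means, cross-multiplied, monotonicity required only on the
support), `logConcave_inner` (iterated log-concavity: outer products ≤ inner products), `cdf_logConcave` (the CDF of a log-concave law is
log-concave), `ballD_tp2` (TP₂ of the one-chain ball masses `Σ_r [z + r + w < t] d r` in `(z, w)`), `ball2_eq_levels` (level regrouping),
Chebyshev's sum inequality in both directions with the sign hypothesis restricted to the support of the weights, and `cell_harris`.
-/

noncomputable section

namespace Summit.CriticalPhenomena.PercolationContinuityZ3.Theorems

namespace SahiOneStep

namespace ThreshGrid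

open Finset

/-! ## Likelihood-ratio order, log-concavity bookkeeping -/

/-- **MLR ⇒ ordered expectations** (cross-multiplied, no division).  If `h′/h` is non-decreasing (`h j·h′ i ≤ h i·h′ j` for
`i ≤ j`) and `φ` is non-decreasing on the joint support of `h, h′`, then `(Σ h′)(Σ h φ) ≤ (Σ h)(Σ h′ φ)`. [folklore] -/
theorem mlr_sum_le (n : ℕ) (h h' φ : ℕ → ℝ) (hmlr : ∀ i j, i ≤ j → h j * h' i ≤ h i * h' j)
    (hφ : ∀ i j, i ≤ j → j < n → (h i ≠ 0 ∨ h' i ≠ 0) → (h j ≠ 0 ∨ h' j ≠ 0) → φ i ≤ φ j) :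
    (∑ i ∈ range n, h' i) * (∑ i ∈ range n, h i * φ i) ≤ (∑ i ∈ range n, h i) * (∑ i ∈ range n, h' i * φ i) := by
  suffices H : ∀ m, m ≤ n →
      (∑ i ∈ range m, h' i) * (∑ i ∈ range m, h i * φ i) ≤ (∑ i ∈ range m, h i) * (∑ i ∈ range m, h' i * φ i) from H n le_rfl
  intro m
  induction m with
  | zero => intro _; simp
  | succ m ih =>
    intro hm
    have ih' := ih (by omega)
    rw [Finset.sum_range_succ, Finset.sum_range_succ, Finset.sum_range_succ, Finset.sum_range_succ]
    have key : 0 ≤ ∑ i ∈ range m, (h i * h' m - h m * h' i) * (φ m - φ i) := by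
      refine Finset.sum_nonneg fun i hi => ?_
      have him : i < m := Finset.mem_range.1 hi
      have h1 : 0 ≤ h i * h' m - h m * h' i := sub_nonneg.2 (hmlr i m him.le)
      by_cases hz : (h i ≠ 0 ∨ h' i ≠ 0)
      · by_cases hz' : (h m ≠ 0 ∨ h' m ≠ 0)
        · exact mul_nonneg h1 (sub_nonneg.2 (hφ i m him.le (by omega) hz hz'))
        · push Not at hz'
          rw [hz'.1, hz'.2]; ring_nf; exact le_rfl
      · push Not at hz
        rw [hz.1, hz.2]; ring_nf; exact le_rfl
    have expand : (∑ i ∈ range m, h i) * (h' m * φ m) - h' m * (∑ i ∈ range m, h i * φ i)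
        + h m * (∑ i ∈ range m, h' i * φ i) - (∑ i ∈ range m, h' i) * (h m * φ m) =
        ∑ i ∈ range m, (h i * h' m - h m * h' i) * (φ m - φ i) := by
      rw [Finset.sum_mul, Finset.mul_sum, Finset.mul_sum, Finset.sum_mul, ← Finset.sum_sub_distrib,
        ← Finset.sum_add_distrib, ← Finset.sum_sub_distrib]
      exact Finset.sum_congr rfl fun i _ => by ring
    nlinarith [ih', key, expand]

/-- **Iterated log-concavity**: for a nonnegative sequence with `d i·d (j+1) ≤ d (i+1)·d j` (`i < j`), outer products are dominated by
inner products with the same index sum: `d r·d (r+m+2δ) ≤ d (r+δ)·d (r+δ+m)`. [folklore] -/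
theorem logConcave_inner (d : ℕ → ℝ) (hdlc : ∀ i j, i < j → d i * d (j + 1) ≤ d (i + 1) * d j) :
    ∀ δ r m, d r * d (r + m + 2 * δ) ≤ d (r + δ) * d (r + δ + m) := by
  intro δ
  induction δ with
  | zero => intro r m; simp
  | succ δ ih =>
    intro r m
    have h1 : d r * d (r + m + 2 * δ + 1 + 1) ≤ d (r + 1) * d (r + m + 2 * δ + 1) := hdlc r (r + m + 2 * δ + 1) (by omega)
    have h2 := ih (r + 1) m
    rw [show r + m + 2 * (δ + 1) = r + m + 2 * δ + 1 + 1 by ring, show r + (δ + 1) = r + 1 + δ by ring]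
    rw [show r + 1 + m + 2 * δ = r + m + 2 * δ + 1 by ring] at h2
    exact h1.trans h2

/-- **The CDF of a log-concave law is log-concave** (same hypothesis form): for `D n = Σ_{r<n} d r` (truncated to `range (N+1)`, `d = 0`
beyond `N`), `D i·D (j+1) ≤ D (i+1)·D j` for `i < j`. [folklore] -/
theorem cdf_logConcave (N : ℕ) (d : ℕ → ℝ) (hd : ∀ r, 0 ≤ d r) (hdN : ∀ r, N < r → d r = 0)
    (hdlc : ∀ i j, i < j → d i * d (j + 1) ≤ d (i + 1) * d j) :
    ∀ i j, i < j → (∑ r ∈ range (N + 1), if r < i then d r else 0) * (∑ r ∈ range (N + 1), if r < j + 1 then d r else 0) ≤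
      (∑ r ∈ range (N + 1), if r < i + 1 then d r else 0) * (∑ r ∈ range (N + 1), if r < j then d r else 0) := by
  -- `D n = Σ_{r ∈ range n} d r`
  have hD : ∀ n, (∑ r ∈ range (N + 1), if r < n then d r else 0) = ∑ r ∈ range n, d r := by
    intro n
    by_cases hn : n ≤ N + 1
    · rw [← Finset.sum_range_add_sum_Ico _ hn]
      have h2 : (∑ r ∈ Finset.Ico n (N + 1), if r < n then d r else 0) = 0 :=
        Finset.sum_eq_zero fun r hr => by rw [if_neg (by simp at hr; omega)]
      rw [h2, add_zero]
      exact Finset.sum_congr rfl fun r hr => by rw [if_pos (Finset.mem_range.1 hr)]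
    · push Not at hn
      rw [← Finset.sum_range_add_sum_Ico _ hn.le]
      have h2 : (∑ r ∈ Finset.Ico (N + 1) n, d r) = 0 :=
        Finset.sum_eq_zero fun r hr => hdN r (by simp at hr; omega)
      rw [h2, add_zero]
      exact Finset.sum_congr rfl fun r hr => by rw [if_pos (lt_of_lt_of_le (Finset.mem_range.1 hr) hn.le)]
  intro i j hij
  have hj1 : (∑ r ∈ range (j + 1), d r) = (∑ r ∈ range j, d r) + d j := Finset.sum_range_succ _ _
  have hi1 : (∑ r ∈ range (i + 1), d r) = (∑ r ∈ range i, d r) + d i := Finset.sum_range_succ _ _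
  rw [hD, hD, hD, hD, hj1, hi1]
  -- reduce to `D i * d j ≤ d i * D j`
  suffices h : (∑ r ∈ range i, d r) * d j ≤ d i * ∑ r ∈ range j, d r by nlinarith [h]
  -- pair `r < i` with `r + (j - i) < j`
  obtain ⟨g, rfl⟩ : ∃ g, j = i + g := ⟨j - i, by omega⟩
  have hsplit : (∑ r ∈ range (i + g), d r) = (∑ r ∈ range g, d r) + ∑ r ∈ range i, d (g + r) := by
    rw [show i + g = g + i by ring, Finset.sum_range_add]
  have hfirst : 0 ≤ d i * ∑ r ∈ range g, d r := mul_nonneg (hd i) (Finset.sum_nonneg fun r _ => hd r)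
  have hpair : ∀ r ∈ range i, d r * d (i + g) ≤ d i * d (g + r) := by
    intro r hr
    have hri : r < i := Finset.mem_range.1 hr
    -- outer pair `(r, i+g)`, inner pair `{i, g+r}` (same sum)
    by_cases hle : i ≤ g + r
    · -- inner sorted `(i, g+r)`: δ = i - r, m = g + r - i
      have := logConcave_inner d hdlc (i - r) r (g + r - i)
      rw [show r + (g + r - i) + 2 * (i - r) = i + g by omega, show r + (i - r) = i by omega,
        show i + (g + r - i) = g + r by omega] at this
      exact this
    · push Not at hle
      have := logConcave_inner d hdlc g r (i - g - r)
      rw [show r + (i - g - r) + 2 * g = i + g by omega, show r + g + (i - g - r) = i by omega,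
        show r + g = g + r by ring] at this
      rw [mul_comm (d i)]; exact this
  have hsum : (∑ r ∈ range i, d r * d (i + g)) ≤ ∑ r ∈ range i, d i * d (g + r) := Finset.sum_le_sum hpair
  rw [← Finset.sum_mul, ← Finset.mul_sum] at hsum
  rw [hsplit, mul_add]
  linarith [hsum, hfirst]

/-- Ball masses of one chain: `Σ_r [z + r + w < t] d r = D (t − z − w)` with `D n = Σ [r < n] d r`. [folklore] -/
theorem ballD_eq (N t z w : ℕ) (d : ℕ → ℝ) :
    (∑ r ∈ range (N + 1), if z + r + w < t then d r else 0) = ∑ r ∈ range (N + 1), if r < t - z - w then d r else 0 :=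
  Finset.sum_congr rfl fun r _ => by
    by_cases h : z + r + w < t
    · rw [if_pos h, if_pos (by omega)]
    · rw [if_neg h, if_neg (by omega)]

/-- **TP₂ of the one-chain ball masses**: for a log-concave `d`, `S(z,w) = Σ_r [z + r + w < t] d r` satisfies
`S(z′,w′)·S(z,w) ≤ S(z,w′)·S(z′,w)` for `z ≤ z′`, `w ≤ w′` (log-concavity of the CDF, inner ≥ outer). [folklore] -/
theorem ballD_tp2 (N t : ℕ) (d : ℕ → ℝ) (hd : ∀ r, 0 ≤ d r) (hdN : ∀ r, N < r → d r = 0)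
    (hdlc : ∀ i j, i < j → d i * d (j + 1) ≤ d (i + 1) * d j) {z z' w w' : ℕ} (hz : z ≤ z') (hw : w ≤ w') :
    (∑ r ∈ range (N + 1), if z' + r + w' < t then d r else 0) * (∑ r ∈ range (N + 1), if z + r + w < t then d r else 0) ≤
      (∑ r ∈ range (N + 1), if z + r + w' < t then d r else 0) * (∑ r ∈ range (N + 1), if z' + r + w < t then d r else 0) := by
  set D : ℕ → ℝ := fun n => ∑ r ∈ range (N + 1), if r < n then d r else 0 with hDdef
  have hD0 : ∀ n, 0 ≤ D n := fun n => Finset.sum_nonneg fun r _ => by split_ifs; exacts [hd r, le_rfl]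
  have hDlc : ∀ i j, i < j → D i * D (j + 1) ≤ D (i + 1) * D j := cdf_logConcave N d hd hdN hdlc
  rw [ballD_eq N t z' w', ballD_eq N t z w, ballD_eq N t z w', ballD_eq N t z' w]
  change D (t - z' - w') * D (t - z - w) ≤ D (t - z - w') * D (t - z' - w)
  by_cases ht : z' + w' < t
  · obtain ⟨m₁, hm₁⟩ : ∃ m₁, t = z' + w' + m₁ + 1 := ⟨t - z' - w' - 1, by omega⟩
    obtain ⟨δz, rfl⟩ : ∃ δz, z' = z + δz := ⟨z' - z, by omega⟩
    obtain ⟨δw, rfl⟩ : ∃ δw, w' = w + δw := ⟨w' - w, by omega⟩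
    have e1 : t - (z + δz) - (w + δw) = m₁ + 1 := by omega
    have e2 : t - z - w = m₁ + 1 + δw + δz := by omega
    have e3 : t - z - (w + δw) = m₁ + 1 + δz := by omega
    have e4 : t - (z + δz) - w = m₁ + 1 + δw := by omega
    rw [e1, e2, e3, e4]
    by_cases hzw : δz ≤ δw
    · have := logConcave_inner D hDlc δz (m₁ + 1) (δw - δz)
      rw [show m₁ + 1 + (δw - δz) + 2 * δz = m₁ + 1 + δw + δz by omega,
        show m₁ + 1 + δz + (δw - δz) = m₁ + 1 + δw by omega] at this
      exact this
    · push Not at hzw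
      have := logConcave_inner D hDlc δw (m₁ + 1) (δz - δw)
      rw [show m₁ + 1 + (δz - δw) + 2 * δw = m₁ + 1 + δw + δz by omega,
        show m₁ + 1 + δw + (δz - δw) = m₁ + 1 + δz by omega] at this
      rw [mul_comm (D (m₁ + 1 + δz))]; exact this
  · have h0 : D (t - z' - w') = 0 := by
      rw [show t - z' - w' = 0 by omega]
      exact Finset.sum_eq_zero fun r _ => by rw [if_neg (by omega)]
    rw [h0, zero_mul]; exact mul_nonneg (hD0 _) (hD0 _)

/-- Level regrouping of a two-chain ball sum: `Σ_{z,r} [z+r+w<t] c z d r = Σ_m [m+w<t] e m`, `e m = Σ_{z+r=m} c z d r`. [folklore] -/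
theorem ball2_eq_levels (M N t w : ℕ) (c d : ℕ → ℝ) :
    (∑ z ∈ range (M + 1), ∑ r ∈ range (N + 1), if z + r + w < t then c z * d r else 0) =
      ∑ m ∈ range (M + N + 1), if m + w < t then
        (∑ z ∈ range (M + 1), ∑ r ∈ range (N + 1), if z + r = m then c z * d r else 0) else 0 := by
  have hrhs : (∑ m ∈ range (M + N + 1), if m + w < t then
        (∑ z ∈ range (M + 1), ∑ r ∈ range (N + 1), if z + r = m then c z * d r else 0) else (0:ℝ)) =
      ∑ m ∈ range (M + N + 1), ∑ z ∈ range (M + 1), ∑ r ∈ range (N + 1),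
        if z + r = m then (if z + r + w < t then c z * d r else 0) else 0 := by
    refine Finset.sum_congr rfl fun m _ => ?_
    by_cases h : m + w < t
    · rw [if_pos h]
      exact Finset.sum_congr rfl fun z _ => Finset.sum_congr rfl fun r _ => by
        by_cases hzr : z + r = m
        · rw [if_pos hzr, if_pos hzr, if_pos (by omega)]
        · rw [if_neg hzr, if_neg hzr]
    · rw [if_neg h]; symm
      exact Finset.sum_eq_zero fun z _ => Finset.sum_eq_zero fun r _ => by
        by_cases hzr : z + r = m
        · rw [if_pos hzr, if_neg (by omega)]
        · rw [if_neg hzr]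
  have inner : ∀ z ∈ range (M + 1), (∑ r ∈ range (N + 1), if z + r + w < t then c z * d r else 0) =
      ∑ m ∈ range (M + N + 1), ∑ r ∈ range (N + 1),
        if z + r = m then (if z + r + w < t then c z * d r else 0) else 0 := by
    intro z hz
    rw [Finset.sum_comm]
    refine Finset.sum_congr rfl fun r hr => ?_
    have hzr : z + r ∈ range (M + N + 1) := by
      simp only [Finset.mem_range] at hz hr ⊢; omega
    symm
    exact Finset.sum_ite_eq_of_mem _ (z + r) (fun _ => if z + r + w < t then c z * d r else 0) hzr
  rw [hrhs]
  conv_rhs => rw [Finset.sum_comm]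
  exact Finset.sum_congr rfl inner


/-! ## Chebyshev with zero-weight exceptions -/

/-- Chebyshev's sum inequality for oppositely ordered pairs, the sign being required only on the support of the weights. [folklore] -/
theorem sum_mul_sum_le_of_pairs' (n : ℕ) (u F G : ℕ → ℝ) (hu : ∀ k, 0 ≤ u k)
    (hFG : ∀ k k', k < k' → k' < n → u k ≠ 0 → u k' ≠ 0 → (F k - F k') * (G k - G k') ≤ 0) :
    (∑ k ∈ range n, u k) * (∑ k ∈ range n, u k * F k * G k) ≤ (∑ k ∈ range n, u k * F k) * (∑ k ∈ range n, u k * G k) := by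
  have h := ThreeChain.lagrange_cov n u F G
  have hneg : (∑ k ∈ range n, ∑ k' ∈ range n, if k < k' then u k * u k' * (F k - F k') * (G k - G k') else (0:ℝ)) ≤ 0 := by
    refine Finset.sum_nonpos fun k hk => Finset.sum_nonpos fun k' hk' => ?_
    split_ifs with hlt
    · by_cases hk0 : u k = 0
      · rw [hk0]; simp
      by_cases hk0' : u k' = 0
      · rw [hk0']; simp
      have := hFG k k' hlt (by simpa using hk') hk0 hk0'
      have huu : 0 ≤ u k * u k' := mul_nonneg (hu k) (hu k')
      nlinarith
    · exact le_rfl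
  linarith

/-- Chebyshev's sum inequality for similarly ordered pairs (sign needed only on the support of the weights). [folklore] -/
theorem sum_mul_sum_ge_of_pairs' (n : ℕ) (u F G : ℕ → ℝ) (hu : ∀ k, 0 ≤ u k)
    (hFG : ∀ k k', k < k' → k' < n → u k ≠ 0 → u k' ≠ 0 → 0 ≤ (F k - F k') * (G k - G k')) :
    (∑ k ∈ range n, u k * F k) * (∑ k ∈ range n, u k * G k) ≤ (∑ k ∈ range n, u k) * (∑ k ∈ range n, u k * F k * G k) := by
  have h := ThreeChain.lagrange_cov n u F G
  have hpos : 0 ≤ (∑ k ∈ range n, ∑ k' ∈ range n, if k < k' then u k * u k' * (F k - F k') * (G k - G k') else (0:ℝ)) := by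
    refine Finset.sum_nonneg fun k hk => Finset.sum_nonneg fun k' hk' => ?_
    split_ifs with hlt
    · by_cases hk0 : u k = 0
      · rw [hk0]; simp
      by_cases hk0' : u k' = 0
      · rw [hk0']; simp
      have := hFG k k' hlt (by simpa using hk') hk0 hk0'
      have huu : 0 ≤ u k * u k' := mul_nonneg (hu k) (hu k')
      have : 0 ≤ u k * u k' * ((F k - F k') * (G k - G k')) := mul_nonneg huu this
      linarith [this]
    · exact le_rfl
  linarith

/-- **(B1) Harris on the shared chain**: two tails of `Z` are positively correlated (`Σ c = 1`). [folklore] -/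
theorem cell_harris (M : ℕ) (c : ℕ → ℝ) (hc : ∀ z, 0 ≤ c z) (hc1 : ∑ z ∈ range (M + 1), c z = 1) (u v : ℕ) :
    (∑ z ∈ range (M + 1), if u ≤ z then c z else 0) * (∑ z ∈ range (M + 1), if v ≤ z then c z else 0) ≤
      ∑ z ∈ range (M + 1), if u ≤ z ∧ v ≤ z then c z else 0 := by
  have h := sum_mul_sum_ge_of_pairs' (M + 1) c (fun z => if u ≤ z then (1:ℝ) else 0) (fun z => if v ≤ z then (1:ℝ) else 0) hc
    (fun i j hij _ _ _ => by
      apply mul_nonneg_of_nonpos_of_nonpos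
      · by_cases hi : u ≤ i
        · rw [if_pos hi, if_pos (by omega)]; simp
        · rw [if_neg hi]; split_ifs <;> norm_num
      · by_cases hi : v ≤ i
        · rw [if_pos hi, if_pos (by omega)]; simp
        · rw [if_neg hi]; split_ifs <;> norm_num)
  rw [hc1, one_mul] at h
  have e1 : (∑ z ∈ range (M + 1), c z * (if u ≤ z then (1:ℝ) else 0)) = ∑ z ∈ range (M + 1), if u ≤ z then c z else 0 :=
    Finset.sum_congr rfl fun z _ => by split_ifs <;> simp
  have e2 : (∑ z ∈ range (M + 1), c z * (if v ≤ z then (1:ℝ) else 0)) = ∑ z ∈ range (M + 1), if v ≤ z then c z else 0 :=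
    Finset.sum_congr rfl fun z _ => by split_ifs <;> simp
  have e3 : (∑ z ∈ range (M + 1), c z * (if u ≤ z then (1:ℝ) else 0) * (if v ≤ z then (1:ℝ) else 0)) =
      ∑ z ∈ range (M + 1), if u ≤ z ∧ v ≤ z then c z else 0 :=
    Finset.sum_congr rfl fun z _ => by
      by_cases hu : u ≤ z
      · by_cases hv : v ≤ z
        · rw [if_pos hu, if_pos hv, if_pos ⟨hu, hv⟩]; ring
        · rw [if_pos hu, if_neg hv, if_neg (show ¬(u ≤ z ∧ v ≤ z) from fun h => hv h.2)]; ring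
      · rw [if_neg hu, if_neg (show ¬(u ≤ z ∧ v ≤ z) from fun h => hu h.1)]; ring
  rw [e1, e2, e3] at h
  exact h

end ThreshGrid

end SahiOneStep

end Summit.CriticalPhenomena.PercolationContinuityZ3.Theorems
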